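import Mathlib.NumberTheory.LSeries.Dirichlet
import Mathlib.Analysis.SpecialFunctions.JapaneseBracket
import Mathlib.Analysis.Analytic.IsolatedZeros
import Mathlib.Analysis.Normed.Module.Connected
import Mathlib.Topology.Compactness.Lindelof
import Literature.NumberTheory.LFunctions.NymanBeurling
import Literature.NumberTheory.LFunctions.NymanBeurlingDirichlet
import Literature.Analysis.FunctionSpaces.PlancherelL1L2
import HarnessLib

/-!
# The Nyman–Beurling–Báez-Duarte criterion: the deep half from its printed inputs

Companion ("Proofs") file of `Literature/NumberTheory/LFunctions/NymanBeurling.lean`. There the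
named fact `Literature.NumberTheory.LFunctions.baezDuarte_iff` (Báez-Duarte 2003, Thm. 1.1: RH iff `χ = 𝟙_{(0,1]}` lies in the
`L²(0,∞)`-closure of the span of `ρ_a(x) = {1/(ax)}`, `a ∈ ℕ`) was reduced to its deep half
`baezDuarte_onlyIf` (RH ⇒ closure), the elementary half being proved. This file proves the deep
half from the three classical inputs of Báez-Duarte's §2.2, all recorded as named facts in
`NymanBeurling.lean`:

* `baezDuarte_moebiusSum_approx` — Lemma 2.1 (Balazard–Saias, *Notes 1*, Lemme 2): under a
  zero-free half-plane `re s > α`, `∑_{a≤n} μ(a)a^{-s} = 1/ζ(s) + O(n^{-δ/3}(1+|τ|)^ε)`;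
* `baezDuarte_zetaRatio_bound` — Lemma 2.2: `|ζ(1/2-ε+iτ)/ζ(1/2+ε+iτ)| ≤ C(1+|τ|)^ε`;
* `zeta_isBigO_rpow_of_riemannHypothesis` — Titchmarsh (14.2.5): RH ⇒ `ζ(σ+it) = O(t^ε)`,
  `σ > 1/2` (with Lemma 2.2 this is the "Lindelöf hypothesis at the abscissa `1/2-ε`" of §2.2).

## Main results (all proved)

* `Literature.NumberTheory.LFunctions.baezDuarte_onlyIf_of_approx` : `baezDuarte_onlyIf` from Lemma 2.2, (14.2.5) and, in
  place of Lemma 2.1, the abstract Dirichlet-polynomial approximation property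
  `Literature.RH.InvZetaDirichletApprox ε` of `1/ζ` (under RH, all small `ε > 0`).
* `Literature.NumberTheory.LFunctions.invZetaDirichletApprox_of_moebiusSum_approx` : Lemma 2.1 gives that property (under RH),
  with Báez-Duarte's own polynomials `P_n(s + 2ε)`.
* `Literature.NumberTheory.LFunctions.baezDuarte_onlyIf_of_facts` : the three facts imply `baezDuarte_onlyIf`.
* `Literature.NumberTheory.LFunctions.baezDuarte_iff_of_facts` : the three facts imply `baezDuarte_iff` (Thm. 1.1).

## The argument (Báez-Duarte §2.2, in quantitative form)

Mathlib has no `L²`-Mellin transform, so instead of the two `L²`-limits `f_{ε,n} → f_ε`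
(`n → ∞`) and `f_ε → -χ` (`ε → 0`) of the source we estimate directly the norm of
`g_c = χ - ∑_k c_k ρ_{k+1}` (`BaezDuarteOnlyIf.approx c`, literally the expression in
`Literature.NumberTheory.LFunctions.baezDuarte_iff`) for a real coefficient vector `c`; Báez-Duarte's choice
`c_k = -μ(k+1)(k+1)^{-2ε}`, `k < n` (`BaezDuarteOnlyIf.coeff ε n`) gives
`g_c = χ + f_{2ε,n} = χ + ∑_{a≤n} μ(a)a^{-2ε}ρ_a`. The Mellin transform of `g_c` converges
absolutely on `0 < re s < 1`, and:

1. `M[g_c](w) = (1 - ζ(w)D_c(w))/w` with the Dirichlet polynomial `D_c(w) = -∑_k c_k (k+1)^{-w}`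
   (`mellin_approxC_eq`; from `M[χ](w) = 1/w` and Titchmarsh's (2.1.5)
   `M[{1/(ax)}](w) = -a^{-w}ζ(w)/w`, `NymanBeurling.mellin_fract_one_div_eq`) — Báez-Duarte (2.4);
   for his coefficients `D_c(w) = P_n(w+2ε)`, `P_n(s) = ∑_{a≤n} μ(a)a^{-s}` (`dirichletPoly_coeff`).
2. Mellin–Plancherel at abscissa `1/2 - ε` (`Literature.Analysis.FunctionSpaces.integral_norm_sq_mellin_eq`, file
   `Literature/Analysis/FunctionSpaces/PlancherelL1L2.lean`), `x^{-2ε} ≥ 1` on `(0,1]` and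
   `g_c(x) = -C/x` on `(1,∞)` (`C = ∑ c_k/(k+1) = -D_c(1)`) give
   `‖g_c‖² ≤ (2π)⁻¹ ∫ |M[g_c](1/2-ε+iτ)|² dτ + C²` (`integral_sq_approx_le_mellin`); for
   Báez-Duarte's coefficients `C = -P_n(1+2ε) → -1/ζ(1+2ε)` (`n → ∞`), and `1/ζ(1+2ε) → 0`
   (`ε → 0`).
3. On the line, with `w = 1/2-ε+iτ`, `v = 1/2+ε+iτ`:
   `|1 - ζ(w)D_c(w)|²/|w|² ≤ 2A(ε,τ) + 2|ζ(w)|²|D_c(w) - 1/ζ(v)|²/|w|²`,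
   `A(ε,τ) = |1 - ζ(w)/ζ(v)|²/|w|²`. By Lemma 2.2, `A(ε,·) ≤ 32(1+C_R)²(1+|τ|)^{-7/4}` for
   `ε ≤ 1/8`, and `A(ε,τ) → 0` as `ε → 0` whenever `ζ(1/2+iτ) ≠ 0`, i.e. for a.e. `τ` (the zeros
   of `ζ` are isolated); dominated convergence gives `∫A(ε,·) → 0` (`tendsto_integral_Afun`).
   If `|D_c(w) - 1/ζ(v)| ≤ K(1+|τ|)^{1/8}` (for `D_c = P_n(·+2ε)` this is Lemma 2.1 with
   `α = 1/2`, `δ = ε`, `K = C₁n^{-ε/3}`, needs RH), Lemma 2.2 and (14.2.5) bound the second term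
   by `32(C_R C₃ K)²(1+|τ|)^{-5/4}` (`norm_sq_mellin_le`).
4. Choose `ε` small (steps 2–3), then `K` small (`n` large): `‖g_c‖ < η`
   (`baezDuarte_onlyIf_of_approx`, `baezDuarte_onlyIf_of_facts`).

## References

* L. Báez-Duarte, *A strengthening of the Nyman–Beurling criterion for the Riemann hypothesis*,
  Atti Accad. Naz. Lincei Rend. Lincei (9) Mat. Appl. 14 (2003), 5–11 (arXiv:math/0202141),
  Thm. 1.1, Lemmas 2.1–2.2, §2.2.
* M. Balazard, E. Saias, *Notes sur la fonction ζ de Riemann, 1*, Adv. Math. 139 (1998),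
  310–321, Lemme 2.
* E. C. Titchmarsh, *The Theory of the Riemann Zeta-Function*, 2nd ed., OUP 1986, (2.1.5) and
  §14.2 (14.2.5); *Introduction to the Theory of Fourier Integrals*, 2nd ed., 1948, Thm. 71.
-/

noncomputable section

open Complex Filter Asymptotics MeasureTheory Set
open scoped Real Topology

namespace Literature.NumberTheory.LFunctions


/-! ## The approximants `χ - ∑_k c_k ρ_{k+1}` -/

namespace BaezDuarteOnlyIf

open ArithmeticFunction (moebius)

variable {N : ℕ}

/-- The function `g_c = χ - ∑_k c_k {1/((k+1)x)}` attached to a real coefficient vector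
`c : Fin N → ℝ`, literally in the form of the right-hand side of `Literature.NumberTheory.LFunctions.baezDuarte_iff`; its
`L²(0,∞)` norm is to be made small. Báez-Duarte's choice is `c = coeff ε n` below
(`g = χ + f_{2ε,n}`). [cite: BaezDuarte2003, §2.2] -/
def approx (c : Fin N → ℝ) (x : ℝ) : ℝ :=
  (Ioc (0 : ℝ) 1).indicator 1 x -
    ∑ k : Fin N, c k * Int.fract (1 / (((k : ℕ) + 1 : ℝ) * x))

/-- The tail constant `C = ∑_k c_k/(k+1)`: on `(1,∞)`, `g_c(x) = -C/x`.
[cite: BaezDuarte2003, §2.2 eq. for `x > 1`] -/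
def tailConst (c : Fin N → ℝ) : ℝ := ∑ k : Fin N, c k / ((k : ℕ) + 1)

/-- A crude sup bound for `g_c`: `1 + ∑_k |c_k|`. [folklore] -/
def coeffBound (c : Fin N → ℝ) : ℝ := 1 + ∑ k : Fin N, |c k|

/-! The Dirichlet polynomial attached to `c` is `D_c(s) = -∑_k c_k (k+1)^{-s}`, i.e. the tree's
`Literature.RH.dirichletPoly (fun k ↦ -(c k : ℂ)) s` (`Literature/…/NymanBeurlingDirichlet.lean`,
`dirichletPoly a s = ∑ a_n (n+1)^{-s}`); it is normalised so that `M[g_c](s) = (1 - ζ(s) D_c(s))/s`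
(`mellin_approxC_eq`), and for Báez-Duarte's coefficients `D_c(s) = P_n(s + 2ε)` with
`P_n(s) = ∑_{a ≤ n} μ(a) a^{-s}` (`dirichletPoly_coeff`). -/

/-- Báez-Duarte's coefficients, in the indexing of `Literature.NumberTheory.LFunctions.baezDuarte_iff`:
`c_k = -μ(k+1)(k+1)^{-2ε}` for `k < n`, so that `χ - ∑_k c_k ρ_{k+1} = χ + f_{2ε,n}` with
`f_{ε,n} = ∑_{a ≤ n} μ(a)a^{-ε}ρ_a` (§2.2). [cite: BaezDuarte2003, §2.2] -/
def coeff (ε : ℝ) (n : ℕ) (k : Fin n) : ℝ :=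
  -((moebius ((k : ℕ) + 1) : ℝ) * ((k : ℕ) + 1 : ℝ) ^ (-(2 * ε)))

/-- `1 ≤ coeffBound c`. [folklore] -/
lemma one_le_coeffBound (c : Fin N → ℝ) : 1 ≤ coeffBound c := by
  unfold coeffBound
  have : 0 ≤ ∑ k : Fin N, |c k| := Finset.sum_nonneg fun k _ ↦ abs_nonneg _
  linarith

/-- `g_c` is measurable. [folklore] -/
lemma measurable_approx (c : Fin N → ℝ) : Measurable (approx c) := by
  refine (measurable_one.indicator measurableSet_Ioc).sub (Finset.measurable_sum _ fun k _ ↦ ?_)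
  exact measurable_const.mul (measurable_fract.comp (by fun_prop))

/-- `|g_c(x)| ≤ 1 + ∑_k |c_k|` everywhere. [folklore] -/
lemma abs_approx_le (c : Fin N → ℝ) (x : ℝ) : |approx c x| ≤ coeffBound c := by
  unfold approx coeffBound
  refine (abs_sub _ _).trans (add_le_add ?_ ?_)
  · by_cases hx : x ∈ Ioc (0 : ℝ) 1 <;> simp [hx]
  · refine (Finset.abs_sum_le_sum_abs _ _).trans (Finset.sum_le_sum fun k _ ↦ ?_)
    rw [abs_mul]
    refine (mul_le_mul_of_nonneg_left ?_ (abs_nonneg _)).trans_eq (mul_one _)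
    rw [abs_of_nonneg (Int.fract_nonneg _)]
    exact (Int.fract_lt_one _).le

/-- On `(1,∞)`: `g_c(x) = -C x⁻¹` (`χ = 0` and `{1/((k+1)x)} = 1/((k+1)x)` there). [folklore] -/
lemma approx_eq_of_one_lt (c : Fin N → ℝ) {x : ℝ} (hx : 1 < x) :
    approx c x = -tailConst c * x⁻¹ := by
  have hx0 : 0 < x := by linarith
  have hxm : x ∉ Ioc (0 : ℝ) 1 := fun h' ↦ absurd h'.2 (not_le.2 hx)
  simp only [approx, indicator_of_notMem hxm, zero_sub, tailConst, neg_mul, Finset.sum_mul,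
    neg_inj]
  refine Finset.sum_congr rfl fun k _ ↦ ?_
  have hk : (0 : ℝ) < (k : ℕ) + 1 := by positivity
  rw [Int.fract_eq_self.2 ⟨by positivity, ?_⟩]
  · field_simp
  · rw [div_lt_one (by positivity)]; nlinarith

/-- `|g_c(x)| = |C| x⁻¹` on `(1, ∞)`. [folklore] -/
lemma abs_approx_le_of_one_lt (c : Fin N → ℝ) {x : ℝ} (hx : 1 < x) :
    |approx c x| = |tailConst c| * x⁻¹ := by
  rw [approx_eq_of_one_lt c hx, abs_mul, abs_neg, abs_of_pos (inv_pos.2 (zero_lt_one.trans hx))]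

/-- The complexification of `g_c` (Mellin transforms are `ℂ`-valued). [folklore] -/
def approxC (c : Fin N → ℝ) (x : ℝ) : ℂ := ((approx c x : ℝ) : ℂ)

/-- `approxC` is measurable. [folklore] -/
lemma measurable_approxC (c : Fin N → ℝ) : Measurable (approxC c) :=
  Complex.measurable_ofReal.comp (measurable_approx c)

/-- `‖approxC x‖ = |approx x|`. [folklore] -/
lemma norm_approxC (c : Fin N → ℝ) (x : ℝ) : ‖approxC c x‖ = |approx c x| := by
  rw [approxC, Complex.norm_real, Real.norm_eq_abs]

/-- Reindexing `Fin n ↔ {1, …, n}`. [folklore] -/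
lemma sum_fin_eq_sum_Icc {M : Type*} [AddCommMonoid M] (n : ℕ) (f : ℕ → M) :
    ∑ k : Fin n, f ((k : ℕ) + 1) = ∑ a ∈ Finset.Icc 1 n, f a := by
  induction n with
  | zero => simp
  | succ n ih =>
    rw [Fin.sum_univ_castSucc, Finset.sum_Icc_succ_top (by omega)]
    simp [ih]

/-- `approxC` as a `ℂ`-linear combination of the indicator and the Beurling functions. [folklore] -/
lemma approxC_eq (c : Fin N → ℝ) (x : ℝ) :
    approxC c x = (Ioc (0 : ℝ) 1).indicator (fun _ ↦ (1 : ℂ)) x -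
      ∑ k : Fin N, (c k : ℂ) * ((Int.fract (1 / (((k : ℕ) + 1 : ℝ) * x)) : ℝ) : ℂ) := by
  unfold approxC approx
  by_cases hx : x ∈ Ioc (0 : ℝ) 1
  · simp only [indicator_of_mem hx, Pi.one_apply]
    push_cast
    rfl
  · simp only [indicator_of_notMem hx, zero_sub]
    push_cast
    rfl

/-! ## Mellin transforms on `0 < re s < 1` -/
/-- Splitting of the Mellin integrand of `t ↦ {1/t}` at `t = 1`. [folklore] -/
lemma cpow_smul_fract_one_div_eq (s : ℂ) {t : ℝ} (ht : 0 < t) :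
    (t : ℂ) ^ (s - 1) • (((Int.fract (1 / t) : ℝ) : ℂ)) =
      (t : ℂ) ^ (s - 1) • beurlingRhoTrunc 1 t +
        (Ioi (1 : ℝ)).indicator (fun u : ℝ ↦ (u : ℂ) ^ (s - 2)) t := by
  by_cases ht1 : t ≤ 1
  · have hmem : t ∈ Ioc (0 : ℝ) 1 := ⟨ht, ht1⟩
    simp only [beurlingRhoTrunc, indicator_of_mem hmem, one_mul,
      indicator_of_notMem (fun h : t ∈ Ioi (1 : ℝ) ↦ absurd ht1 (not_le.2 h)), add_zero]
  · rw [not_le] at ht1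
    have hfr : Int.fract (1 / t) = 1 / t := by
      rw [Int.fract_eq_self]
      exact ⟨by positivity, by rw [div_lt_one ht]; exact ht1⟩
    have ht2 : (t : ℂ) ≠ 0 := by exact_mod_cast ht.ne'
    rw [beurlingRhoTrunc_eq_zero_of_one_lt 1 ht1, smul_zero, zero_add,
      indicator_of_mem (show t ∈ Ioi (1 : ℝ) from ht1), hfr, smul_eq_mul,
      show s - 2 = (s - 1) + (-1) by ring, cpow_add _ _ ht2, cpow_neg_one]
    push_cast
    ring

/-- `t ↦ {1/t}` has an absolutely convergent Mellin transform on `0 < re s < 1` (bounded near `0`,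
equal to `1/t` on `(1,∞)`). [folklore] -/
lemma mellinConvergent_fract_one_div {s : ℂ} (hs0 : 0 < s.re) (hs1 : s.re < 1) :
    MellinConvergent (fun t : ℝ ↦ ((Int.fract (1 / t) : ℝ) : ℂ)) s := by
  have hint2 : Integrable ((Ioi (1 : ℝ)).indicator (fun u : ℝ ↦ (u : ℂ) ^ (s - 2)))
      (volume.restrict (Ioi 0)) :=
    ((integrableOn_Ioi_cpow_of_lt (by simp; linarith) zero_lt_one).integrable_indicator
      measurableSet_Ioi).restrict
  refine ((mellinConvergent_beurlingRhoTrunc 1 hs0).add hint2).congr ?_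
  filter_upwards [ae_restrict_mem measurableSet_Ioi] with t ht
  exact (cpow_smul_fract_one_div_eq s ht).symm

/-- Mellin transform of the natural Beurling function `x ↦ {1/(ax)}` (`a > 0`) on `0 < re s < 1`:
`∫_0^∞ {1/(ax)} x^{s-1} dx = -a^{-s} ζ(s)/s` (Titchmarsh (2.1.5) after `x ↦ ax`; the identity
behind Báez-Duarte's (2.4)). [cite: Titchmarsh1986, §2.1 (2.1.5)] -/
lemma hasMellin_fract_one_div_mul {a : ℝ} (ha : 0 < a) {s : ℂ} (hs0 : 0 < s.re) (hs1 : s.re < 1) :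
    HasMellin (fun t : ℝ ↦ ((Int.fract (1 / (a * t)) : ℝ) : ℂ)) s
      ((a : ℂ) ^ (-s) * (-riemannZeta s / s)) := by
  have h1 := mellinConvergent_fract_one_div hs0 hs1
  refine ⟨(MellinConvergent.comp_mul_left ha
    (f := fun t : ℝ ↦ ((Int.fract (1 / t) : ℝ) : ℂ))).2 h1, ?_⟩
  have := mellin_comp_mul_left (fun t : ℝ ↦ ((Int.fract (1 / t) : ℝ) : ℂ)) s ha
  rw [mellin_fract_one_div_eq hs0 hs1, smul_eq_mul] at this
  exact this

/-- **Mellin transform of the approximant** on `0 < re s < 1`: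
`M[g_c](s) = 1/s + (ζ(s)/s) ∑_k c_k (k+1)^{-s}` (from `M[χ](s) = 1/s` and
`M[{1/(ax)}](s) = -a^{-s}ζ(s)/s`). [cite: BaezDuarte2003, §2.2 (2.4)] -/
lemma hasMellin_approxC (c : Fin N → ℝ) {s : ℂ} (hs0 : 0 < s.re) (hs1 : s.re < 1) :
    HasMellin (approxC c) s
      (1 / s + riemannZeta s / s * ∑ k : Fin N, (c k : ℂ) * (((k : ℕ) : ℂ) + 1) ^ (-s)) := by
  set μ0 : Measure ℝ := volume.restrict (Ioi 0) with hμ0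
  have hind := hasMellin_one_Ioc (s := s) hs0
  have hfr : ∀ k : Fin N, HasMellin
      (fun t : ℝ ↦ ((Int.fract (1 / (((k : ℕ) + 1 : ℝ) * t)) : ℝ) : ℂ)) s
      (((((k : ℕ) + 1 : ℝ)) : ℂ) ^ (-s) * (-riemannZeta s / s)) :=
    fun k ↦ hasMellin_fract_one_div_mul (by positivity) hs0 hs1
  have hlin : (fun t : ℝ ↦ (t : ℂ) ^ (s - 1) • approxC c t) = fun t : ℝ ↦
      (t : ℂ) ^ (s - 1) • (Ioc (0 : ℝ) 1).indicator (fun _ ↦ (1 : ℂ)) t -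
        ∑ k : Fin N, (c k : ℂ) *
          ((t : ℂ) ^ (s - 1) • (((Int.fract (1 / (((k : ℕ) + 1 : ℝ) * t)) : ℝ) : ℂ))) := by
    funext t
    rw [approxC_eq, smul_sub, smul_eq_mul, smul_eq_mul, Finset.mul_sum]
    congr 1
    exact Finset.sum_congr rfl fun k _ ↦ by rw [smul_eq_mul]; ring
  have hint2 : ∀ k : Fin N, Integrable (fun t : ℝ ↦ (c k : ℂ) *
      ((t : ℂ) ^ (s - 1) • (((Int.fract (1 / (((k : ℕ) + 1 : ℝ) * t)) : ℝ) : ℂ)))) μ0 :=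
    fun k ↦ (hfr k).1.const_mul _
  refine ⟨?_, ?_⟩
  · show Integrable _ μ0
    rw [hlin]
    exact hind.1.sub (integrable_finsetSum _ fun k _ ↦ hint2 k)
  · rw [mellin, hlin, integral_sub hind.1 (integrable_finsetSum _ fun k _ ↦ hint2 k),
      integral_finsetSum _ fun k _ ↦ hint2 k]
    have h1 : ∫ x in Ioi (0 : ℝ), (x : ℂ) ^ (s - 1) •
        (Ioc (0 : ℝ) 1).indicator (fun _ ↦ (1 : ℂ)) x = 1 / s := hind.2
    have h2 : ∀ k : Fin N, ∫ x in Ioi (0 : ℝ), (c k : ℂ) * ((x : ℂ) ^ (s - 1) •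
        (((Int.fract (1 / (((k : ℕ) + 1 : ℝ) * x)) : ℝ) : ℂ))) =
        (c k : ℂ) * (((((k : ℕ) + 1 : ℝ)) : ℂ) ^ (-s) * (-riemannZeta s / s)) := by
      intro k
      rw [integral_const_mul]
      exact congrArg _ (hfr k).2
    rw [h1, Finset.sum_congr rfl fun k _ ↦ h2 k, Finset.mul_sum, sub_eq_add_neg,
      ← Finset.sum_neg_distrib]
    congr 1
    refine Finset.sum_congr rfl fun k _ ↦ ?_
    push_cast
    ring

/-- **Mellin transform of the approximant** in closed form (Báez-Duarte (2.4) plus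
`M[χ](s) = 1/s`): `M[g_c](w) = (1 - ζ(w) D_c(w))/w` for `0 < re w < 1`.
[cite: BaezDuarte2003, §2.2 (2.4)] -/
lemma mellin_approxC_eq (c : Fin N → ℝ) {w : ℂ} (hw0 : 0 < w.re) (hw1 : w.re < 1) :
    mellin (approxC c) w = (1 - riemannZeta w * dirichletPoly (fun k ↦ -(c k : ℂ)) w) / w := by
  rw [(hasMellin_approxC c hw0 hw1).2, dirichletPoly]
  simp only [neg_mul, Finset.sum_neg_distrib]
  ring

/-- `D_c(1) = -C` (the tail constant). [folklore] -/
lemma dirichletPoly_one (c : Fin N → ℝ) :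
    dirichletPoly (fun k ↦ -(c k : ℂ)) 1 = -(tailConst c : ℂ) := by
  unfold dirichletPoly tailConst
  push_cast
  rw [← Finset.sum_neg_distrib]
  refine Finset.sum_congr rfl fun k _ ↦ ?_
  rw [cpow_neg_one, div_eq_mul_inv, neg_mul]

/-- The Dirichlet polynomial `P_n(s) = ∑_{a ≤ n} μ(a) a^{-s}` of Lemma 2.1 (the left-hand side of
`baezDuarte_moebiusSum_approx`). [cite: BaezDuarte2003, Lemma 2.1] -/
def moebiusSum (n : ℕ) (s : ℂ) : ℂ := ∑ a ∈ Finset.Icc 1 n, (moebius a : ℂ) / (a : ℂ) ^ s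

/-- The coefficient sum in `hasMellin_approxC` for Báez-Duarte's coefficients is `-P_n(s + 2ε)`.
[folklore] -/
lemma sum_coeff_mul_cpow (ε : ℝ) (n : ℕ) (s : ℂ) :
    ∑ k : Fin n, (coeff ε n k : ℂ) * (((k : ℕ) : ℂ) + 1) ^ (-s) = -moebiusSum n (s + 2 * ε) := by
  unfold moebiusSum
  rw [← sum_fin_eq_sum_Icc, ← Finset.sum_neg_distrib]
  refine Finset.sum_congr rfl fun k _ ↦ ?_
  have hk : (0 : ℝ) ≤ (k : ℕ) + 1 := by positivity
  have hk' : (((k : ℕ) : ℂ) + 1) ≠ 0 := by exact_mod_cast Nat.succ_ne_zero k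
  simp only [coeff]
  push_cast
  rw [Complex.ofReal_cpow hk]
  push_cast
  rw [div_eq_mul_inv, ← cpow_neg, neg_mul, neg_inj, mul_assoc, ← cpow_add _ _ hk']
  congr 2
  ring

/-- For Báez-Duarte's coefficients, `D_c(s) = P_n(s + 2ε)`. [cite: BaezDuarte2003, §2.2 (2.4)] -/
lemma dirichletPoly_coeff (ε : ℝ) (n : ℕ) (s : ℂ) :
    dirichletPoly (fun k ↦ -(coeff ε n k : ℂ)) s = moebiusSum n (s + 2 * ε) := by
  rw [dirichletPoly]
  simp only [neg_mul, Finset.sum_neg_distrib, sum_coeff_mul_cpow, neg_neg]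


/-! ## The Plancherel step: `‖g_c‖² ≤ (2π)⁻¹ ∫ |M[g_c](1/2-ε+iτ)|² dτ + C²` -/

/-- The Mellin transform of `g_c` converges absolutely at real `0 < σ < 1`. [folklore] -/
lemma mellinConvergent_approxC (c : Fin N → ℝ) {σ : ℝ} (h0 : 0 < σ) (h1 : σ < 1) :
    MellinConvergent (approxC c) (σ : ℂ) :=
  (hasMellin_approxC c (s := (σ : ℂ)) (by simpa using h0) (by simpa using h1)).1

/-- `∫_0^∞ |g_c(x)|² x^r dx < ∞` for `-1 < r < 1` (bounded on `(0,1]`, `≍ x⁻¹` at `∞`).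
[folklore] -/
lemma integrableOn_norm_sq_approxC_mul_rpow (c : Fin N → ℝ) {r : ℝ} (hr0 : -1 < r)
    (hr1 : r < 1) : IntegrableOn (fun x : ℝ ↦ ‖approxC c x‖ ^ 2 * x ^ r) (Ioi 0) := by
  rw [← Ioc_union_Ioi_eq_Ioi zero_le_one]
  refine IntegrableOn.union ?_ ?_
  · have hI : IntegrableOn (fun x : ℝ ↦ coeffBound c ^ 2 * x ^ r) (Ioc 0 1) :=
      (intervalIntegral.intervalIntegrable_rpow' hr0 (a := 0) (b := 1)).1.const_mul _
    refine hI.mono' ?_ ?_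
    · exact (((measurable_approxC c).norm.pow_const 2).mul
        (measurable_id.pow_const r)).aestronglyMeasurable
    · filter_upwards [ae_restrict_mem measurableSet_Ioc] with x hx
      have hxr : 0 ≤ x ^ r := Real.rpow_nonneg hx.1.le r
      rw [Real.norm_eq_abs, abs_of_nonneg (by positivity)]
      refine mul_le_mul_of_nonneg_right ?_ hxr
      rw [norm_approxC]
      have h := abs_approx_le c x
      have h0 : 0 ≤ |approx c x| := abs_nonneg _
      nlinarith
  · have hI : IntegrableOn (fun x : ℝ ↦ (tailConst c) ^ 2 * x ^ (r - 2)) (Ioi 1) :=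
      (integrableOn_Ioi_rpow_of_lt (by linarith) zero_lt_one).const_mul _
    refine hI.congr_fun (fun x hx ↦ ?_) measurableSet_Ioi
    have hx0 : 0 < x := zero_lt_one.trans hx
    simp only
    rw [norm_approxC, abs_approx_le_of_one_lt c hx, mul_pow, sq_abs,
      Real.rpow_sub hx0, Real.rpow_two, inv_pow]
    field_simp

/-- `∫_0^∞ |g_c|² < ∞`. [folklore] -/
lemma integrableOn_sq_approx (c : Fin N → ℝ) :
    IntegrableOn (fun x : ℝ ↦ approx c x ^ 2) (Ioi 0) := by
  have h := integrableOn_norm_sq_approxC_mul_rpow c (r := 0) (by norm_num) (by norm_num)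
  refine h.congr_fun (fun x _ ↦ ?_) measurableSet_Ioi
  simp only
  rw [Real.rpow_zero, mul_one, norm_approxC, sq_abs]

/-- The tail: `∫_1^∞ |g_c|² = C²`. [folklore] -/
lemma integral_Ioi_one_sq_approx (c : Fin N → ℝ) :
    ∫ x in Ioi (1 : ℝ), approx c x ^ 2 = tailConst c ^ 2 := by
  have h1 : ∫ x in Ioi (1 : ℝ), approx c x ^ 2 =
      ∫ x in Ioi (1 : ℝ), tailConst c ^ 2 * x ^ (-2 : ℝ) := by
    refine setIntegral_congr_fun measurableSet_Ioi fun x hx ↦ ?_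
    have hx0 : 0 < x := zero_lt_one.trans hx
    rw [approx_eq_of_one_lt c hx, mul_pow, neg_sq, Real.rpow_neg hx0.le, Real.rpow_two, inv_pow]
  rw [h1, integral_const_mul, integral_Ioi_rpow_of_lt (by norm_num) zero_lt_one]
  norm_num

/-- **Key `L²` inequality.** For `0 ≤ ε` and `σ = 1/2 - ε ∈ (0,1)`:
`∫_0^∞ |g_c|² ≤ ∫_0^∞ |g_c(x)|² x^{2σ-1} dx + C²`, because `x^{-2ε} ≥ 1` on `(0,1]` and
`g_c = -C/x` on `(1,∞)` ("`x^{-ε} > 1` for `0 < x < 1`, and for `x > 1` … `≪ 1/x`",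
Báez-Duarte §2.2). [cite: BaezDuarte2003, §2.2] -/
lemma integral_sq_approx_le {ε : ℝ} (hε : 0 ≤ ε) (hε1 : ε < 1 / 2) (c : Fin N → ℝ) :
    ∫ x in Ioi (0 : ℝ), approx c x ^ 2 ≤
      (∫ x in Ioi (0 : ℝ), ‖approxC c x‖ ^ 2 * x ^ (2 * (1 / 2 - ε) - 1)) + tailConst c ^ 2 := by
  have hr0 : -1 < 2 * (1 / 2 - ε) - 1 := by linarith
  have hr1 : 2 * (1 / 2 - ε) - 1 < 1 := by linarith
  have hW := integrableOn_norm_sq_approxC_mul_rpow c hr0 hr1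
  have hS := integrableOn_sq_approx c
  rw [← integral_Ioi_one_sq_approx c]
  have hsplit : ∫ x in Ioi (0 : ℝ), approx c x ^ 2 =
      (∫ x in Ioc (0 : ℝ) 1, approx c x ^ 2) + ∫ x in Ioi (1 : ℝ), approx c x ^ 2 := by
    rw [← Ioc_union_Ioi_eq_Ioi zero_le_one, setIntegral_union
      (Ioc_disjoint_Ioi_same) measurableSet_Ioi
      (hS.mono_set Ioc_subset_Ioi_self) (hS.mono_set (Ioi_subset_Ioi zero_le_one))]
  rw [hsplit]
  refine add_le_add ?_ le_rfl
  calc ∫ x in Ioc (0 : ℝ) 1, approx c x ^ 2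
      ≤ ∫ x in Ioc (0 : ℝ) 1, ‖approxC c x‖ ^ 2 * x ^ (2 * (1 / 2 - ε) - 1) := by
        refine setIntegral_mono_on (hS.mono_set Ioc_subset_Ioi_self)
          (hW.mono_set Ioc_subset_Ioi_self) measurableSet_Ioc fun x hx ↦ ?_
        rw [norm_approxC, sq_abs]
        have h1 : 1 ≤ x ^ (2 * (1 / 2 - ε) - 1) :=
          Real.one_le_rpow_of_pos_of_le_one_of_nonpos hx.1 hx.2 (by linarith)
        have h2 : 0 ≤ approx c x ^ 2 := sq_nonneg _
        nlinarith
    _ ≤ ∫ x in Ioi (0 : ℝ), ‖approxC c x‖ ^ 2 * x ^ (2 * (1 / 2 - ε) - 1) :=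
        setIntegral_mono_set hW ?_ Ioc_subset_Ioi_self.eventuallyLE
  filter_upwards [ae_restrict_mem measurableSet_Ioi] with x hx
  exact mul_nonneg (sq_nonneg _) (Real.rpow_nonneg (le_of_lt hx) _)


/-- **Mellin–Plancherel for the approximant** at abscissa `1/2 - ε` (`0 ≤ ε < 1/2`):
`∫ |M[g_c](1/2-ε+iτ)|² dτ = 2π ∫_0^∞ |g_c(x)|² x^{-2ε} dx` (the isometry `𝓗 → 𝓚` of
Báez-Duarte §2.2 applied to `X_ε g`; here via `Literature.Analysis.FunctionSpaces.integral_norm_sq_mellin_eq`).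
[cite: BaezDuarte2003, §2.2] -/
lemma plancherel_approxC {ε : ℝ} (hε : 0 ≤ ε) (hε1 : ε < 1 / 2) (c : Fin N → ℝ) :
    Integrable (fun τ : ℝ ↦ ‖mellin (approxC c) (((1 / 2 - ε : ℝ) : ℂ) + τ * I)‖ ^ 2) ∧
      ∫ τ : ℝ, ‖mellin (approxC c) (((1 / 2 - ε : ℝ) : ℂ) + τ * I)‖ ^ 2 =
        2 * π * ∫ x in Ioi 0, ‖approxC c x‖ ^ 2 * x ^ (2 * (1 / 2 - ε) - 1) :=
  Literature.Analysis.FunctionSpaces.integral_norm_sq_mellin_eq (mellinConvergent_approxC c (by linarith) (by linarith))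
    (integrableOn_norm_sq_approxC_mul_rpow c (by linarith) (by linarith))

/-- `‖g_c‖²_{L²(0,∞)} ≤ (2π)⁻¹ ∫ |M[g_c](1/2-ε+iτ)|² dτ + C²`. [cite: BaezDuarte2003, §2.2] -/
lemma integral_sq_approx_le_mellin {ε : ℝ} (hε : 0 ≤ ε) (hε1 : ε < 1 / 2) (c : Fin N → ℝ) :
    ∫ x in Ioi (0 : ℝ), approx c x ^ 2 ≤
      (2 * π)⁻¹ * (∫ τ : ℝ, ‖mellin (approxC c) (((1 / 2 - ε : ℝ) : ℂ) + τ * I)‖ ^ 2) +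
        tailConst c ^ 2 := by
  rw [(plancherel_approxC hε hε1 c).2, ← mul_assoc, inv_mul_cancel₀ (by positivity), one_mul]
  exact integral_sq_approx_le hε hε1 c

/-! ## Facts about `ζ` on vertical lines -/

/-- `τ ↦ ζ(σ + iτ)` is continuous for `σ ≠ 1`. [folklore] -/
lemma continuous_zeta_line {σ : ℝ} (hσ : σ ≠ 1) :
    Continuous fun τ : ℝ ↦ riemannZeta (σ + τ * I) := by
  refine continuous_iff_continuousAt.2 fun τ ↦ ?_
  have hne : (σ : ℂ) + τ * I ≠ 1 := by
    intro h
    apply hσ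
    have := congrArg Complex.re h
    simpa using this
  have hc : Continuous fun τ : ℝ ↦ (σ : ℂ) + τ * I := by fun_prop
  change ContinuousAt (riemannZeta ∘ fun τ : ℝ ↦ (σ : ℂ) + τ * I) τ
  exact ContinuousAt.comp (differentiableAt_riemannZeta hne).continuousAt hc.continuousAt

/-- Conjugation symmetry on vertical lines: `‖ζ(σ - iτ)‖ = ‖ζ(σ + iτ)‖`. [folklore] -/
lemma norm_zeta_line_neg (σ τ : ℝ) :
    ‖riemannZeta (σ + (-τ : ℝ) * I)‖ = ‖riemannZeta (σ + τ * I)‖ := by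
  have h : (σ : ℂ) + ((-τ : ℝ) : ℂ) * I = starRingEnd ℂ ((σ : ℂ) + τ * I) := by
    apply Complex.ext <;> simp
  rw [h, riemannZeta_conj, Complex.norm_conj]

/-- From `ζ(σ+it) = O(t^δ)` as `t → +∞` (`σ ≠ 1`, `δ ≥ 0`) to a bound on the whole line:
`‖ζ(σ+iτ)‖ ≤ C(1+|τ|)^δ` for all real `τ` (continuity on compacta and `ζ(s̄) = ζ(s)⁻`).
[folklore] -/
lemma zeta_line_bound_of_isBigO {σ δ : ℝ} (hσ : σ ≠ 1) (hδ : 0 ≤ δ)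
    (h : (fun t : ℝ ↦ riemannZeta (σ + t * I)) =O[atTop] fun t : ℝ ↦ t ^ δ) :
    ∃ C : ℝ, 0 < C ∧ ∀ τ : ℝ, ‖riemannZeta (σ + τ * I)‖ ≤ C * (1 + |τ|) ^ δ := by
  obtain ⟨c, hc⟩ := h.bound
  obtain ⟨T, hT⟩ := eventually_atTop.1 hc
  set T' : ℝ := max T 0 with hT'
  obtain ⟨B, hB⟩ : ∃ B, ∀ τ ∈ Icc (-T') T', ‖riemannZeta (σ + τ * I)‖ ≤ B :=
    isCompact_Icc.exists_bound_of_continuousOn (continuous_zeta_line hσ).continuousOn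
  refine ⟨max (max c B) 1, by positivity, fun τ ↦ ?_⟩
  have h1 : 1 ≤ (1 + |τ|) ^ δ := Real.one_le_rpow (by linarith [abs_nonneg τ]) hδ
  have h0 : 0 ≤ (1 + |τ|) ^ δ := zero_le_one.trans h1
  rcases le_or_gt (|τ|) T' with hτ | hτ
  · have := hB τ ⟨by linarith [neg_abs_le τ], (le_abs_self τ).trans hτ⟩
    calc ‖riemannZeta (σ + τ * I)‖ ≤ B := this
      _ ≤ max (max c B) 1 := (le_max_right _ _).trans (le_max_left _ _)
      _ ≤ max (max c B) 1 * (1 + |τ|) ^ δ := le_mul_of_one_le_right (by positivity) h1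
  · have hτT : T ≤ |τ| := (le_max_left _ _).trans hτ.le
    have key : ‖riemannZeta (σ + (|τ| : ℝ) * I)‖ ≤ c * ‖(|τ| : ℝ) ^ δ‖ := hT _ hτT
    have hsymm : ‖riemannZeta (σ + τ * I)‖ = ‖riemannZeta (σ + (|τ| : ℝ) * I)‖ := by
      rcases le_or_gt 0 τ with h0τ | h0τ
      · rw [abs_of_nonneg h0τ]
      · rw [abs_of_neg h0τ, norm_zeta_line_neg]
    have h2 : ‖(|τ| : ℝ) ^ δ‖ ≤ (1 + |τ|) ^ δ := by
      rw [Real.norm_eq_abs, abs_of_nonneg (Real.rpow_nonneg (abs_nonneg τ) δ)]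
      exact Real.rpow_le_rpow (abs_nonneg τ) (by linarith) hδ
    calc ‖riemannZeta (σ + τ * I)‖ ≤ c * ‖(|τ| : ℝ) ^ δ‖ := hsymm ▸ key
      _ ≤ max (max c B) 1 * ‖(|τ| : ℝ) ^ δ‖ :=
          mul_le_mul_of_nonneg_right ((le_max_left _ _).trans (le_max_left _ _)) (norm_nonneg _)
      _ ≤ max (max c B) 1 * (1 + |τ|) ^ δ := mul_le_mul_of_nonneg_left h2 (by positivity)

/-- `ζ` is analytic on `ℂ ∖ {1}`. [folklore] -/
lemma analyticOnNhd_riemannZeta : AnalyticOnNhd ℂ riemannZeta {1}ᶜ := by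
  have h : DifferentiableOn ℂ riemannZeta {1}ᶜ :=
    fun _ hs ↦ (differentiableAt_riemannZeta hs).differentiableWithinAt
  exact h.analyticOnNhd isOpen_compl_singleton

/-- The zeros of `ζ` are isolated (`ζ(2) ≠ 0` and `ℂ ∖ {1}` is connected). [folklore] -/
lemma eventually_riemannZeta_ne_zero {z₀ : ℂ} (hz₀ : z₀ ≠ 1) :
    ∀ᶠ z in 𝓝[≠] z₀, riemannZeta z ≠ 0 := by
  rcases (analyticOnNhd_riemannZeta z₀ hz₀).eventually_eq_zero_or_eventually_ne_zero with h | h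
  · exfalso
    have hU : IsPreconnected ({1}ᶜ : Set ℂ) :=
      (isConnected_compl_singleton_of_one_lt_rank (by simp) (1 : ℂ)).isPreconnected
    have h2 : riemannZeta 2 = 0 :=
      analyticOnNhd_riemannZeta.eqOn_zero_of_preconnected_of_eventuallyEq_zero hU hz₀ h
        (show (2 : ℂ) ∈ ({1}ᶜ : Set ℂ) by norm_num)
    exact riemannZeta_ne_zero_of_one_lt_re (by norm_num : 1 < (2 : ℂ).re) h2
  · exact h

/-- The zero set of `ζ` is countable. [folklore] -/
lemma countable_riemannZeta_zeros : {z : ℂ | z ≠ 1 ∧ riemannZeta z = 0}.Countable := by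
  apply (HereditarilyLindelofSpace.isLindelof _).countable_of_isDiscrete
  rw [isDiscrete_iff_nhdsNE]
  rintro z ⟨hz1, hz0⟩
  rw [inf_principal_eq_bot]
  filter_upwards [eventually_riemannZeta_ne_zero hz1] with w hw
  exact fun h ↦ hw h.2

/-- The ordinates of the zeros of `ζ` on the critical line form a Lebesgue-null set (they are
countable). [folklore] -/
lemma ae_riemannZeta_half_ne_zero : ∀ᵐ τ : ℝ, riemannZeta (1 / 2 + τ * I) ≠ 0 := by
  have hinj : Function.Injective fun τ : ℝ ↦ (1 / 2 + τ * I : ℂ) := by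
    intro a b hab
    have := congrArg Complex.im hab
    simpa using this
  have hsub : {τ : ℝ | riemannZeta (1 / 2 + τ * I) = 0} =
      (fun τ : ℝ ↦ (1 / 2 + τ * I : ℂ)) ⁻¹' {z : ℂ | z ≠ 1 ∧ riemannZeta z = 0} := by
    ext τ
    simp only [mem_setOf_eq, mem_preimage, iff_and_self]
    intro _ h
    have := congrArg Complex.re h
    norm_num at this
  have hc : {τ : ℝ | riemannZeta (1 / 2 + τ * I) = 0}.Countable := by
    rw [hsub]
    exact countable_riemannZeta_zeros.preimage_of_injOn hinj.injOn
  rw [ae_iff]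
  simpa using hc.measure_zero volume

/-! ## Estimates on the line `re s = 1/2 - ε` -/

/-- Elementary inequality: `‖(1 - z P)/w‖² ≤ 2‖1 - z/v‖²/‖w‖² + 2‖z‖²‖P - v⁻¹‖²/‖w‖²`
(write `1 - zP = (1 - z/v) + z(v⁻¹ - P)`). [folklore] -/
lemma norm_sq_div_le (z v P w : ℂ) :
    ‖(1 - z * P) / w‖ ^ 2 ≤
      2 * (‖1 - z / v‖ ^ 2 / ‖w‖ ^ 2) + 2 * (‖z‖ ^ 2 * ‖P - v⁻¹‖ ^ 2 / ‖w‖ ^ 2) := by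
  have hdecomp : 1 - z * P = (1 - z / v) + z * (v⁻¹ - P) := by ring
  have h1 : ‖1 - z * P‖ ≤ ‖1 - z / v‖ + ‖z‖ * ‖P - v⁻¹‖ := by
    rw [hdecomp]
    refine (norm_add_le _ _).trans (add_le_add le_rfl ?_)
    rw [norm_mul, ← norm_neg (P - v⁻¹), neg_sub]
  have h2 : ‖1 - z * P‖ ^ 2 ≤ 2 * ‖1 - z / v‖ ^ 2 + 2 * (‖z‖ ^ 2 * ‖P - v⁻¹‖ ^ 2) := by
    have ha := norm_nonneg (1 - z / v)
    have hb : 0 ≤ ‖z‖ * ‖P - v⁻¹‖ := by positivity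
    have h0 := norm_nonneg (1 - z * P)
    nlinarith [h1, sq_nonneg (‖1 - z / v‖ - ‖z‖ * ‖P - v⁻¹‖)]
  rw [norm_div, div_pow, ← mul_div_assoc, ← mul_div_assoc, ← add_div]
  exact div_le_div_of_nonneg_right h2 (sq_nonneg _)


/-- `ζ` is Borel measurable (continuous off the single point `1`). [folklore] -/
lemma measurable_riemannZeta : Measurable riemannZeta :=
  measurable_of_continuousOn_compl_singleton 1
    fun _ hs ↦ (differentiableAt_riemannZeta hs).continuousAt.continuousWithinAt

/-- The "A-term" of the line estimate: `A(ε,τ) = |1 - ζ(1/2-ε+iτ)/ζ(1/2+ε+iτ)|² / |1/2-ε+iτ|²`,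
which tends to `0` (a.e. in `τ`) as `ε ↓ 0` and is dominated via Lemma 2.2.
[cite: BaezDuarte2003, §2.2] -/
def Afun (ε τ : ℝ) : ℝ :=
  ‖1 - riemannZeta (1 / 2 - ε + τ * I) / riemannZeta (1 / 2 + ε + τ * I)‖ ^ 2 /
    ‖(1 / 2 - ε + τ * I : ℂ)‖ ^ 2

/-- `A(ε,τ) ≥ 0`. [folklore] -/
lemma Afun_nonneg (ε τ : ℝ) : 0 ≤ Afun ε τ := by
  unfold Afun; positivity

/-- `A(ε,·)` is measurable (`ζ` is measurable). [folklore] -/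
lemma measurable_Afun (ε : ℝ) : Measurable (Afun ε) := by
  unfold Afun
  have h1 : Measurable fun τ : ℝ ↦ riemannZeta (1 / 2 - ε + τ * I) :=
    measurable_riemannZeta.comp (by fun_prop)
  have h2 : Measurable fun τ : ℝ ↦ riemannZeta (1 / 2 + ε + τ * I) :=
    measurable_riemannZeta.comp (by fun_prop)
  exact ((measurable_const.sub (h1.div h2)).norm.pow_const 2).div
    ((by fun_prop : Measurable fun τ : ℝ ↦ (1 / 2 - ε + τ * I : ℂ)).norm.pow_const 2)

/-- `|1/2 - ε + iτ|² = (1/2-ε)² + τ²`. [folklore] -/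
lemma norm_sq_w (ε τ : ℝ) : ‖(1 / 2 - ε + τ * I : ℂ)‖ ^ 2 = (1 / 2 - ε) ^ 2 + τ ^ 2 := by
  have h : (1 / 2 - ε + τ * I : ℂ) = ((1 / 2 - ε : ℝ) : ℂ) + τ * I := by push_cast; ring
  rw [h, Complex.norm_add_mul_I, Real.sq_sqrt (by positivity)]

/-- For `ε ≤ 1/4`: `x/|1/2-ε+iτ|² ≤ 32 x (1+|τ|)^{-2}` (`x ≥ 0`). [folklore] -/
lemma div_norm_sq_w_le {ε : ℝ} (h1 : ε ≤ 1 / 4) (τ : ℝ) {x : ℝ} (hx : 0 ≤ x) :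
    x / ‖(1 / 2 - ε + τ * I : ℂ)‖ ^ 2 ≤ 32 * x * (1 + |τ|) ^ (-2 : ℝ) := by
  rw [norm_sq_w, Real.rpow_neg (by positivity), Real.rpow_two, mul_assoc, ← div_eq_mul_inv]
  have hlow : 0 < (1 / 2 - ε) ^ 2 + τ ^ 2 := by nlinarith
  calc x / ((1 / 2 - ε) ^ 2 + τ ^ 2) ≤ x / ((1 + |τ|) ^ 2 / 32) := by
        refine div_le_div_of_nonneg_left hx (by positivity) ?_
        rw [div_le_iff₀ (by norm_num : (0 : ℝ) < 32)]
        have hτ : |τ| ^ 2 = τ ^ 2 := sq_abs τ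
        nlinarith [abs_nonneg τ, sq_nonneg (|τ| - 1)]
    _ = 32 * (x / (1 + |τ|) ^ 2) := by
        rw [div_div_eq_mul_div]
        ring

/-- **Domination of the A-term via Lemma 2.2.** If `|ζ(1/2-ε+iτ)/ζ(1/2+ε+iτ)| ≤ C_R(1+|τ|)^ε` for
`0 ≤ ε ≤ 1/8`, then `A(ε,τ) ≤ 32(1+C_R)²(1+|τ|)^{-7/4}`, an integrable majorant independent of
`ε`. [cite: BaezDuarte2003, §2.2 (use of Lemma 2.2)] -/
lemma Afun_le {C_R : ℝ} (hC : 0 < C_R)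
    (hR : ∀ ε τ : ℝ, 0 ≤ ε → ε ≤ 1 / 8 →
      ‖riemannZeta (1 / 2 - ε + τ * I) / riemannZeta (1 / 2 + ε + τ * I)‖ ≤ C_R * (1 + |τ|) ^ ε)
    {ε : ℝ} (h0 : 0 ≤ ε) (h1 : ε ≤ 1 / 8) (τ : ℝ) :
    Afun ε τ ≤ 32 * (1 + C_R) ^ 2 * (1 + |τ|) ^ (-(7 / 4) : ℝ) := by
  set t : ℝ := 1 + |τ| with ht_def
  have ht : 1 ≤ t := by simp [ht_def]
  have ht0 : 0 < t := by linarith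
  have hnum : ‖1 - riemannZeta (1 / 2 - ε + τ * I) / riemannZeta (1 / 2 + ε + τ * I)‖ ≤
      (1 + C_R) * t ^ (1 / 8 : ℝ) := by
    refine (norm_sub_le _ _).trans ?_
    rw [norm_one]
    have e1 : 1 ≤ t ^ (1 / 8 : ℝ) := Real.one_le_rpow ht (by norm_num)
    have e2 : ‖riemannZeta (1 / 2 - ε + τ * I) / riemannZeta (1 / 2 + ε + τ * I)‖ ≤
        C_R * t ^ (1 / 8 : ℝ) :=
      (hR ε τ h0 h1).trans (mul_le_mul_of_nonneg_left
        (Real.rpow_le_rpow_of_exponent_le ht h1) hC.le)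
    nlinarith
  have hnum2 : ‖1 - riemannZeta (1 / 2 - ε + τ * I) / riemannZeta (1 / 2 + ε + τ * I)‖ ^ 2 ≤
      (1 + C_R) ^ 2 * t ^ (1 / 4 : ℝ) := by
    calc _ ≤ ((1 + C_R) * t ^ (1 / 8 : ℝ)) ^ 2 := pow_le_pow_left₀ (norm_nonneg _) hnum 2
      _ = (1 + C_R) ^ 2 * t ^ (1 / 4 : ℝ) := by
          rw [mul_pow, ← Real.rpow_natCast (t ^ (1 / 8 : ℝ)) 2, ← Real.rpow_mul ht0.le]
          norm_num
  unfold Afun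
  calc _ ≤ 32 * ‖1 - riemannZeta (1 / 2 - ε + τ * I) / riemannZeta (1 / 2 + ε + τ * I)‖ ^ 2 *
        (1 + |τ|) ^ (-2 : ℝ) := div_norm_sq_w_le (by linarith) τ (sq_nonneg _)
    _ ≤ 32 * ((1 + C_R) ^ 2 * t ^ (1 / 4 : ℝ)) * t ^ (-2 : ℝ) := by
        rw [← ht_def]
        gcongr
    _ = 32 * (1 + C_R) ^ 2 * t ^ (-(7 / 4) : ℝ) := by
        rw [show (-(7 / 4) : ℝ) = 1 / 4 + (-2) by norm_num, Real.rpow_add ht0]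
        ring

/-- The majorants `(1+|τ|)^{-r}`, `r > 1`, are integrable on `ℝ`. [folklore] -/
lemma integrable_one_add_abs_rpow_neg {r : ℝ} (hr : 1 < r) :
    Integrable fun τ : ℝ ↦ (1 + |τ|) ^ (-r) := by
  have h := integrable_one_add_norm (E := ℝ) (μ := volume) (r := r) (by simpa using hr)
  simpa [Real.norm_eq_abs] using h

/-- `A(ε,·)` is integrable for `0 ≤ ε ≤ 1/8` (dominated by `Afun_le`). [cite: BaezDuarte2003, §2.2] -/
lemma integrable_Afun {C_R : ℝ} (hC : 0 < C_R)
    (hR : ∀ ε τ : ℝ, 0 ≤ ε → ε ≤ 1 / 8 →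
      ‖riemannZeta (1 / 2 - ε + τ * I) / riemannZeta (1 / 2 + ε + τ * I)‖ ≤ C_R * (1 + |τ|) ^ ε)
    {ε : ℝ} (h0 : 0 ≤ ε) (h1 : ε ≤ 1 / 8) : Integrable (Afun ε) := by
  refine (((integrable_one_add_abs_rpow_neg (r := 7 / 4) (by norm_num)).const_mul
    (32 * (1 + C_R) ^ 2)).mono' (measurable_Afun ε).aestronglyMeasurable
    (Eventually.of_forall fun τ ↦ ?_))
  rw [Real.norm_eq_abs, abs_of_nonneg (Afun_nonneg ε τ)]
  exact Afun_le hC hR h0 h1 τ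

/-- **Pointwise limit of the A-term**: if `ζ(1/2+iτ) ≠ 0` then `A(ε,τ) → 0` as `ε → 0` (continuity
of `ζ` at `1/2+iτ`; Báez-Duarte's identification of the pointwise limit (2.5)/(2.3)).
[cite: BaezDuarte2003, §2.2] -/
lemma tendsto_Afun_zero {τ : ℝ} (hτ : riemannZeta (1 / 2 + τ * I) ≠ 0) :
    Tendsto (fun ε : ℝ ↦ Afun ε τ) (𝓝 0) (𝓝 0) := by
  have hz₀ : (1 / 2 + τ * I : ℂ) ≠ 1 := by
    intro h
    have := congrArg Complex.re h
    norm_num at this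
  have hcont : ContinuousAt (fun ε : ℝ ↦ Afun ε τ) 0 := by
    have hζ := (differentiableAt_riemannZeta hz₀).continuousAt
    have c1 : ContinuousAt (fun ε : ℝ ↦ riemannZeta (1 / 2 - ε + τ * I)) 0 :=
      hζ.comp_of_eq (by fun_prop : Continuous fun ε : ℝ ↦ (1 / 2 - ε + τ * I : ℂ)).continuousAt
        (by push_cast; ring)
    have c2 : ContinuousAt (fun ε : ℝ ↦ riemannZeta (1 / 2 + ε + τ * I)) 0 :=
      hζ.comp_of_eq (by fun_prop : Continuous fun ε : ℝ ↦ (1 / 2 + ε + τ * I : ℂ)).continuousAt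
        (by push_cast; ring)
    have hden : ContinuousAt (fun ε : ℝ ↦ ‖(1 / 2 - ε + τ * I : ℂ)‖ ^ 2) 0 :=
      ((by fun_prop : Continuous fun ε : ℝ ↦ (1 / 2 - ε + τ * I : ℂ)).norm.pow 2).continuousAt
    have hden0 : ‖(1 / 2 - (0 : ℝ) + τ * I : ℂ)‖ ^ 2 ≠ 0 := by
      rw [norm_sq_w]
      positivity
    have hv0 : riemannZeta (1 / 2 + ((0 : ℝ) : ℂ) + τ * I) ≠ 0 := by
      simpa using hτ
    unfold Afun
    exact ((continuousAt_const.sub (c1.div c2 hv0)).norm.pow 2).div hden hden0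
  have h0 : Afun 0 τ = 0 := by
    unfold Afun
    have : riemannZeta (1 / 2 - ((0 : ℝ) : ℂ) + τ * I) / riemannZeta (1 / 2 + ((0 : ℝ) : ℂ) + τ * I) = 1 := by
      simpa using div_self hτ
    rw [this]
    simp
  simpa [h0] using hcont.tendsto

/-- **The A-term integral tends to `0`** along `ε_k = 1/(8(k+1))` (dominated convergence with the
majorant of `Afun_le`; the zeros of `ζ` on the critical line form a null set).
[cite: BaezDuarte2003, §2.2] -/
lemma tendsto_integral_Afun {C_R : ℝ} (hC : 0 < C_R)
    (hR : ∀ ε τ : ℝ, 0 ≤ ε → ε ≤ 1 / 8 →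
      ‖riemannZeta (1 / 2 - ε + τ * I) / riemannZeta (1 / 2 + ε + τ * I)‖ ≤ C_R * (1 + |τ|) ^ ε) :
    Tendsto (fun k : ℕ ↦ ∫ τ : ℝ, Afun (1 / (8 * ((k : ℝ) + 1))) τ) atTop (𝓝 0) := by
  have hεk : ∀ k : ℕ, 0 ≤ 1 / (8 * ((k : ℝ) + 1)) ∧ 1 / (8 * ((k : ℝ) + 1)) ≤ 1 / 8 := by
    intro k
    refine ⟨by positivity, ?_⟩
    rw [div_le_div_iff_of_pos_left (by norm_num) (by positivity) (by norm_num)]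
    nlinarith [(Nat.cast_nonneg k : (0 : ℝ) ≤ k)]
  have hlimε : Tendsto (fun k : ℕ ↦ 1 / (8 * ((k : ℝ) + 1))) atTop (𝓝 0) := by
    have h := (tendsto_one_div_add_atTop_nhds_zero_nat (𝕜 := ℝ)).const_mul (1 / 8)
    rw [mul_zero] at h
    refine h.congr fun k ↦ ?_
    field_simp
  have h := tendsto_integral_of_dominated_convergence
    (F := fun (k : ℕ) (τ : ℝ) ↦ Afun (1 / (8 * ((k : ℝ) + 1))) τ) (f := fun _ ↦ (0 : ℝ))
    (μ := volume) (fun τ : ℝ ↦ 32 * (1 + C_R) ^ 2 * (1 + |τ|) ^ (-(7 / 4) : ℝ))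
    (fun k ↦ (measurable_Afun _).aestronglyMeasurable)
    ((integrable_one_add_abs_rpow_neg (r := 7 / 4) (by norm_num)).const_mul _)
    (fun k ↦ Eventually.of_forall fun τ ↦ by
      rw [Real.norm_eq_abs, abs_of_nonneg (Afun_nonneg _ τ)]
      exact Afun_le hC hR (hεk k).1 (hεk k).2 τ)
    (by
      filter_upwards [ae_riemannZeta_half_ne_zero] with τ hτ
      exact (tendsto_Afun_zero hτ).comp hlimε)
  simpa using h


/-- **Pointwise majorant on the line `re s = 1/2 - ε`** (Báez-Duarte §2.2: a Dirichlet
polynomial `D` with `|D(1/2-ε+iτ) - 1/ζ(1/2+ε+iτ)| ≤ K(1+|τ|)^{1/8}` — for `D = P_n(· + 2ε)` this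
is Lemma 2.1 with `α = 1/2`, `δ = ε`, `K = C₁n^{-ε/3}` —, Lemma 2.2, and "Lindelöf at abscissa
`1/2 - ε`" = a bound `|ζ(1/2+ε+iτ)| ≤ C₃(1+|τ|)^{1/8}` combined with Lemma 2.2):
`|M[g_c](1/2-ε+iτ)|² ≤ 2A(ε,τ) + 64 (C_R C₃ K)² (1+|τ|)^{-5/4}`. [cite: BaezDuarte2003, §2.2] -/
lemma norm_sq_mellin_le {ε : ℝ} (h0 : 0 < ε) (h1 : ε ≤ 1 / 8) (c : Fin N → ℝ)
    {C_R K C₃ : ℝ} (hCR : 0 < C_R) (hC3 : 0 < C₃)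
    (hR : ∀ τ : ℝ, ‖riemannZeta (1 / 2 - ε + τ * I) / riemannZeta (1 / 2 + ε + τ * I)‖ ≤
      C_R * (1 + |τ|) ^ ε)
    (hv : ∀ τ : ℝ, riemannZeta (1 / 2 + ε + τ * I) ≠ 0)
    (hD : ∀ τ : ℝ, ‖dirichletPoly (fun k ↦ -(c k : ℂ)) (1 / 2 - ε + τ * I) -
        1 / riemannZeta (1 / 2 + ε + τ * I)‖ ≤
      K * (1 + |τ|) ^ (1 / 8 : ℝ))
    (h3 : ∀ τ : ℝ, ‖riemannZeta (1 / 2 + ε + τ * I)‖ ≤ C₃ * (1 + |τ|) ^ (1 / 8 : ℝ)) (τ : ℝ) :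
    ‖mellin (approxC c) (((1 / 2 - ε : ℝ) : ℂ) + τ * I)‖ ^ 2 ≤
      2 * Afun ε τ + 64 * (C_R * C₃ * K) ^ 2 * (1 + |τ|) ^ (-(5 / 4) : ℝ) := by
  set t : ℝ := 1 + |τ| with ht_def
  have ht : 1 ≤ t := by simp [ht_def]
  have ht0 : 0 < t := by linarith
  have hw : ((1 / 2 - ε : ℝ) : ℂ) + τ * I = 1 / 2 - ε + τ * I := by push_cast; ring
  have hre : (1 / 2 - ε + τ * I : ℂ).re = 1 / 2 - ε := by simp
  rw [hw, mellin_approxC_eq c (by rw [hre]; linarith) (by rw [hre]; linarith)]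
  set z := riemannZeta (1 / 2 - ε + τ * I) with hz
  set v := riemannZeta (1 / 2 + ε + τ * I) with hvdef
  set P := dirichletPoly (fun k ↦ -(c k : ℂ)) (1 / 2 - ε + τ * I) with hP
  refine (norm_sq_div_le z v P _).trans ?_
  have hA : ‖1 - z / v‖ ^ 2 / ‖(1 / 2 - ε + τ * I : ℂ)‖ ^ 2 = Afun ε τ := rfl
  rw [hA]
  refine add_le_add le_rfl ?_
  have ezw : ‖z‖ ≤ C_R * C₃ * t ^ (1 / 4 : ℝ) := by
    have e1 : ‖z / v‖ ≤ C_R * t ^ (1 / 8 : ℝ) :=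
      (hR τ).trans (mul_le_mul_of_nonneg_left (Real.rpow_le_rpow_of_exponent_le ht h1) hCR.le)
    calc ‖z‖ = ‖z / v‖ * ‖v‖ := by rw [← norm_mul, div_mul_cancel₀ _ (hv τ)]
      _ ≤ (C_R * t ^ (1 / 8 : ℝ)) * (C₃ * t ^ (1 / 8 : ℝ)) :=
          mul_le_mul e1 (h3 τ) (norm_nonneg _) (by positivity)
      _ = C_R * C₃ * t ^ (1 / 4 : ℝ) := by
          rw [show (1 / 4 : ℝ) = 1 / 8 + 1 / 8 by norm_num, Real.rpow_add ht0]; ring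
  have eP : ‖P - v⁻¹‖ ≤ K * t ^ (1 / 8 : ℝ) := by
    rw [inv_eq_one_div]
    exact hD τ
  have prod : ‖z‖ * ‖P - v⁻¹‖ ≤ (C_R * C₃ * K) * t ^ (3 / 8 : ℝ) := by
    calc _ ≤ (C_R * C₃ * t ^ (1 / 4 : ℝ)) * (K * t ^ (1 / 8 : ℝ)) :=
          mul_le_mul ezw eP (norm_nonneg _) (by positivity)
      _ = _ := by rw [show (3 / 8 : ℝ) = 1 / 4 + 1 / 8 by norm_num, Real.rpow_add ht0]; ring
  have sq : ‖z‖ ^ 2 * ‖P - v⁻¹‖ ^ 2 ≤ (C_R * C₃ * K) ^ 2 * t ^ (3 / 4 : ℝ) := by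
    rw [← mul_pow]
    calc _ ≤ ((C_R * C₃ * K) * t ^ (3 / 8 : ℝ)) ^ 2 :=
          pow_le_pow_left₀ (by positivity) prod 2
      _ = _ := by
          rw [mul_pow, ← Real.rpow_natCast (t ^ (3 / 8 : ℝ)) 2, ← Real.rpow_mul ht0.le]
          norm_num
  have hX : ‖z‖ ^ 2 * ‖P - v⁻¹‖ ^ 2 / ‖(1 / 2 - ε + τ * I : ℂ)‖ ^ 2 ≤
      32 * ((C_R * C₃ * K) ^ 2 * t ^ (3 / 4 : ℝ)) * t ^ (-2 : ℝ) := by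
    calc _ ≤ 32 * (‖z‖ ^ 2 * ‖P - v⁻¹‖ ^ 2) * (1 + |τ|) ^ (-2 : ℝ) :=
          div_norm_sq_w_le (by linarith) τ (by positivity)
      _ ≤ _ := by rw [← ht_def]; gcongr
  calc 2 * (‖z‖ ^ 2 * ‖P - v⁻¹‖ ^ 2 / ‖(1 / 2 - ε + τ * I : ℂ)‖ ^ 2)
      ≤ 2 * (32 * ((C_R * C₃ * K) ^ 2 * t ^ (3 / 4 : ℝ)) * t ^ (-2 : ℝ)) :=
        mul_le_mul_of_nonneg_left hX (by norm_num)
    _ = 64 * (C_R * C₃ * K) ^ 2 * t ^ (-(5 / 4) : ℝ) := by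
        rw [show (-(5 / 4) : ℝ) = 3 / 4 + (-2) by norm_num, Real.rpow_add ht0]; ring

/-- **Integrated line estimate**:
`∫ |M[g_c](1/2-ε+iτ)|² dτ ≤ 2∫A(ε,·) + 64 (C_R C₃ K)² ∫(1+|τ|)^{-5/4}`.
[cite: BaezDuarte2003, §2.2] -/
lemma integral_norm_sq_mellin_le {ε : ℝ} (h0 : 0 < ε) (h1 : ε ≤ 1 / 8) (c : Fin N → ℝ)
    {C_R K C₃ : ℝ} (hCR : 0 < C_R) (hC3 : 0 < C₃)
    (hR : ∀ ε τ : ℝ, 0 ≤ ε → ε ≤ 1 / 8 →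
      ‖riemannZeta (1 / 2 - ε + τ * I) / riemannZeta (1 / 2 + ε + τ * I)‖ ≤ C_R * (1 + |τ|) ^ ε)
    (hv : ∀ τ : ℝ, riemannZeta (1 / 2 + ε + τ * I) ≠ 0)
    (hD : ∀ τ : ℝ, ‖dirichletPoly (fun k ↦ -(c k : ℂ)) (1 / 2 - ε + τ * I) -
        1 / riemannZeta (1 / 2 + ε + τ * I)‖ ≤
      K * (1 + |τ|) ^ (1 / 8 : ℝ))
    (h3 : ∀ τ : ℝ, ‖riemannZeta (1 / 2 + ε + τ * I)‖ ≤ C₃ * (1 + |τ|) ^ (1 / 8 : ℝ)) :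
    ∫ τ : ℝ, ‖mellin (approxC c) (((1 / 2 - ε : ℝ) : ℂ) + τ * I)‖ ^ 2 ≤
      2 * (∫ τ : ℝ, Afun ε τ) +
        64 * (C_R * C₃ * K) ^ 2 * ∫ τ : ℝ, (1 + |τ|) ^ (-(5 / 4) : ℝ) := by
  have hI := (plancherel_approxC h0.le (by linarith) c).1
  have hA := integrable_Afun hCR hR h0.le h1
  have hB := integrable_one_add_abs_rpow_neg (r := 5 / 4) (by norm_num)
  calc ∫ τ : ℝ, ‖mellin (approxC c) (((1 / 2 - ε : ℝ) : ℂ) + τ * I)‖ ^ 2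
      ≤ ∫ τ : ℝ, (2 * Afun ε τ + 64 * (C_R * C₃ * K) ^ 2 * (1 + |τ|) ^ (-(5 / 4) : ℝ)) :=
        integral_mono hI ((hA.const_mul 2).add (hB.const_mul _))
          fun τ ↦ norm_sq_mellin_le h0 h1 c hCR hC3 (fun τ ↦ hR ε τ h0.le h1) hv hD h3 τ
    _ = _ := by
        rw [integral_add (hA.const_mul 2) (hB.const_mul _), integral_const_mul, integral_const_mul]

/-! ## The limits `n → ∞` and `ε → 0` of the elementary quantities -/

/-- `P_n(s) → 1/ζ(s)` (`n → ∞`) for `re s > 1` (absolutely convergent Dirichlet series of `μ`,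
Mathlib `LSeries_zeta_mul_Lseries_moebius`). [folklore] -/
lemma tendsto_moebiusSum {s : ℂ} (hs : 1 < s.re) :
    Tendsto (fun n ↦ moebiusSum n s) atTop (𝓝 (riemannZeta s)⁻¹) := by
  have hsum : LSeriesHasSum (fun n ↦ (moebius n : ℂ)) s (LSeries (fun n ↦ (moebius n : ℂ)) s) :=
    (ArithmeticFunction.LSeriesSummable_moebius_iff.2 hs).LSeriesHasSum
  have hval : LSeries (fun n ↦ (moebius n : ℂ)) s = (riemannZeta s)⁻¹ := by
    have h := ArithmeticFunction.LSeries_zeta_mul_Lseries_moebius hs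
    rw [ArithmeticFunction.LSeries_zeta_eq_riemannZeta hs] at h
    exact eq_inv_of_mul_eq_one_right h
  have ht := hsum.tendsto_sum_nat
  rw [hval] at ht
  have heq : ∀ n, moebiusSum n s =
      ∑ i ∈ Finset.range (n + 1), LSeries.term (fun n ↦ (moebius n : ℂ)) s i := by
    intro n
    rw [Finset.sum_range_succ', LSeries.term_zero, add_zero, moebiusSum, ← sum_fin_eq_sum_Icc,
      Fin.sum_univ_eq_sum_range (fun i ↦ (moebius (i + 1) : ℂ) / ((i + 1 : ℕ) : ℂ) ^ s) n]
    refine Finset.sum_congr rfl fun i _ ↦ ?_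
    rw [LSeries.term_of_ne_zero (Nat.succ_ne_zero i)]
  simp_rw [heq]
  exact ht.comp (tendsto_add_atTop_nat 1)

/-- For Báez-Duarte's coefficients the tail constant is `-P_n(1 + 2ε)`. [folklore] -/
lemma tailConst_coeff_eq (ε : ℝ) (n : ℕ) :
    (tailConst (coeff ε n) : ℂ) = -moebiusSum n (1 + 2 * ε) := by
  rw [← dirichletPoly_coeff ε n 1, dirichletPoly_one, neg_neg]

/-- `|C| = ‖D_c(1)‖`. [folklore] -/
lemma abs_tailConst_eq (c : Fin N → ℝ) :
    |tailConst c| = ‖dirichletPoly (fun k ↦ -(c k : ℂ)) 1‖ := by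
  rw [dirichletPoly_one, norm_neg, Complex.norm_real, Real.norm_eq_abs]

/-- `1/ζ(1+2ε) → 0` as `ε ↓ 0` (simple pole of `ζ` at `1`, Mathlib `riemannZeta_residue_one`).
[folklore] -/
lemma tendsto_inv_zeta_one :
    Tendsto (fun ε : ℝ ↦ (riemannZeta (1 + 2 * ε))⁻¹) (𝓝[>] 0) (𝓝 0) := by
  have h1 : Tendsto (fun ε : ℝ ↦ (1 + 2 * ε : ℂ)) (𝓝[>] (0 : ℝ)) (𝓝[≠] 1) := by
    refine tendsto_nhdsWithin_of_tendsto_nhds_of_eventually_within _ ?_ ?_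
    · have hc : Continuous fun ε : ℝ ↦ (1 + 2 * ε : ℂ) := by fun_prop
      have h := hc.tendsto 0
      simp only [ofReal_zero, mul_zero, add_zero] at h
      exact h.mono_left nhdsWithin_le_nhds
    · filter_upwards [self_mem_nhdsWithin] with ε (hε : 0 < ε)
      simp only [mem_compl_iff, mem_singleton_iff]
      intro h
      have := congrArg Complex.re h
      simp at this
      exact hε.ne' this
  have h2 := riemannZeta_residue_one.comp h1
  have h3 : Tendsto (fun ε : ℝ ↦ (2 * ε : ℂ)) (𝓝[>] (0 : ℝ)) (𝓝 0) := by
    have hc : Continuous fun ε : ℝ ↦ (2 * ε : ℂ) := by fun_prop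
    have h := hc.tendsto 0
    simp only [ofReal_zero, mul_zero] at h
    exact h.mono_left nhdsWithin_le_nhds
  have h4 := h3.div h2 one_ne_zero
  rw [zero_div] at h4
  refine h4.congr' ?_
  filter_upwards [self_mem_nhdsWithin] with ε (hε : 0 < ε)
  simp only [Function.comp_def, Pi.div_apply]
  have hne : (2 * ε : ℂ) ≠ 0 := mul_ne_zero two_ne_zero (ofReal_ne_zero.2 hε.ne')
  rw [add_sub_cancel_left, div_mul_cancel_left₀ hne]


/-- `L²` conversion: if `∫_0^∞ g² < η²` (`η > 0`, `g ∈ L²`) then `‖g‖_{L²(0,∞)} < η` as an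
`eLpNorm` inequality. [folklore] -/
lemma eLpNorm_lt_of_integral_sq_lt {g : ℝ → ℝ} (hg : Measurable g)
    (hint : IntegrableOn (fun x ↦ g x ^ 2) (Ioi 0)) {η : ℝ} (hη : 0 < η)
    (h : ∫ x in Ioi (0 : ℝ), g x ^ 2 < η ^ 2) :
    eLpNorm g 2 (volume.restrict (Ioi (0 : ℝ))) < ENNReal.ofReal η := by
  have hmem : MemLp g 2 (volume.restrict (Ioi (0 : ℝ))) :=
    (memLp_two_iff_integrable_sq hg.aestronglyMeasurable).2 hint
  rw [hmem.eLpNorm_eq_integral_rpow_norm two_ne_zero ENNReal.ofNat_ne_top,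
    ENNReal.ofReal_lt_ofReal_iff hη]
  simp only [ENNReal.toReal_ofNat, Real.rpow_two, Real.norm_eq_abs, sq_abs]
  have h0 : 0 ≤ ∫ x in Ioi (0 : ℝ), g x ^ 2 := integral_nonneg fun x ↦ sq_nonneg _
  calc (∫ x in Ioi (0 : ℝ), g x ^ 2) ^ (2 : ℝ)⁻¹ < (η ^ 2) ^ (2 : ℝ)⁻¹ :=
        Real.rpow_lt_rpow h0 h (by norm_num)
    _ = η := by
        rw [show ((2 : ℝ)⁻¹) = (1 / 2 : ℝ) by norm_num, ← Real.sqrt_eq_rpow, Real.sqrt_sq hη.le]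

end BaezDuarteOnlyIf
/-! ## Dirichlet-polynomial approximation of `1/ζ` and the assembly -/

open BaezDuarteOnlyIf in
/-- **The Lemma 2.1 input in the form used by the argument.** For the given `ε`: `1/ζ` is
approximable by real-coefficient Dirichlet polynomials `D(s) = ∑_{a ≤ N} d_a a^{-s}` in the sense
that for every `η > 0` some `D` satisfies `|D(1/2-ε+iτ) - 1/ζ(1/2+ε+iτ)| ≤ η(1+|τ|)^{1/8}` for all
real `τ` and `|D(1) - 1/ζ(1+2ε)| ≤ η`. Báez-Duarte takes `D(s) = P_n(s+2ε)`,
`P_n(s) = ∑_{a≤n} μ(a)a^{-s}`, for which this is Lemma 2.1 (under RH, `α = 1/2`, `δ = ε`) on the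
line and the convergence of the Dirichlet series of `μ` at `1 + 2ε`
(`invZetaDirichletApprox_of_moebiusSum_approx`); any other approximating family (e.g. smoothed
partial sums) serves equally. [cite: BaezDuarte2003, §2.2 (role of Lemma 2.1)] -/
def InvZetaDirichletApprox (ε : ℝ) : Prop :=
  ∀ η : ℝ, 0 < η → ∃ (N : ℕ) (d : Fin N → ℝ),
    (∀ τ : ℝ, ‖dirichletPoly (fun k ↦ (d k : ℂ)) (1 / 2 - ε + τ * I) -
      1 / riemannZeta (1 / 2 + ε + τ * I)‖ ≤ η * (1 + |τ|) ^ (1 / 8 : ℝ)) ∧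
    ‖dirichletPoly (fun k ↦ (d k : ℂ)) 1 - 1 / riemannZeta (1 + 2 * ε)‖ ≤ η

open BaezDuarteOnlyIf in
/-- **Lemma 2.1 ⇒ the approximation property**, under RH, for `0 < ε < 1/2`: with `D = P_n(· + 2ε)`,
Lemma 2.1 (`α = 1/2`, `δ = ε`, exponent `1/8`) gives the line bound with constant
`C₁ n^{-ε/3} → 0`, and `P_n(1+2ε) → 1/ζ(1+2ε)` (`tendsto_moebiusSum`).
[cite: BaezDuarte2003, Lemma 2.1 and §2.2] -/
theorem invZetaDirichletApprox_of_moebiusSum_approx (h21 : baezDuarte_moebiusSum_approx)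
    (hRH : RiemannHypothesis) {ε : ℝ} (hε0 : 0 < ε) (hε1 : ε < 1 / 2) :
    InvZetaDirichletApprox ε := by
  intro η hη
  obtain ⟨C₁, hC₁⟩ := h21 (1 / 2) ε (1 / 8) le_rfl (by norm_num) hε0 (by norm_num)
    ((forall_riemannZeta_ne_zero_iff_quasiRiemannHypothesis _).2
      (quasiRiemannHypothesis_one_half_iff_holds.2 hRH))
  set C₁' : ℝ := max C₁ 1 with hC₁'
  have hC₁'pos : 0 < C₁' := lt_max_of_lt_right zero_lt_one
  have h21' : ∀ n : ℕ, 2 ≤ n → ∀ τ : ℝ,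
      ‖moebiusSum n (1 / 2 + ε + τ * I) - 1 / riemannZeta (1 / 2 + ε + τ * I)‖ ≤
        C₁' * (n : ℝ) ^ (-ε / 3) * (1 + |τ|) ^ (1 / 8 : ℝ) := by
    intro n hn τ
    have hs1 : (1 / 2 + ε + τ * I : ℂ) ≠ 1 := by
      intro h
      have := congrArg Complex.re h
      simp at this
      linarith
    have him : (1 / 2 + ε + τ * I : ℂ).im = τ := by simp
    have h := hC₁ n (1 / 2 + ε + τ * I) hn (by simp) (by simp; linarith) hs1
    rw [him] at h
    change ‖moebiusSum n (1 / 2 + ε + τ * I) - 1 / riemannZeta (1 / 2 + ε + τ * I)‖ ≤ _ at h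
    refine h.trans ?_
    have h0 : 0 ≤ (n : ℝ) ^ (-ε / 3) * (1 + |τ|) ^ (1 / 8 : ℝ) :=
      mul_nonneg (Real.rpow_nonneg (Nat.cast_nonneg n) _) (Real.rpow_nonneg (by positivity) _)
    rw [mul_assoc, mul_assoc]
    exact mul_le_mul_of_nonneg_right (le_max_left _ _) h0
  -- choose `n`
  have hpow : Tendsto (fun n : ℕ ↦ C₁' * (n : ℝ) ^ (-ε / 3)) atTop (𝓝 0) := by
    have h := (tendsto_rpow_neg_atTop (by positivity : 0 < ε / 3)).comp
      tendsto_natCast_atTop_atTop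
    have h' : Tendsto (fun n : ℕ ↦ (n : ℝ) ^ (-ε / 3)) atTop (𝓝 0) := by
      refine h.congr fun n ↦ ?_
      simp only [Function.comp_apply, neg_div]
    simpa using h'.const_mul C₁'
  have hn_ev1 : ∀ᶠ n : ℕ in atTop, C₁' * (n : ℝ) ^ (-ε / 3) < η :=
    hpow.eventually (gt_mem_nhds hη)
  have hn_ev2 : ∀ᶠ n : ℕ in atTop,
      ‖moebiusSum n (1 + 2 * ε) - (riemannZeta (1 + 2 * ε))⁻¹‖ < η := by
    have h := tendsto_moebiusSum (s := 1 + 2 * ε) (by simp; linarith)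
    rw [tendsto_iff_norm_sub_tendsto_zero] at h
    exact h.eventually (gt_mem_nhds hη)
  obtain ⟨n, hn1, hn2, hn3⟩ := (hn_ev1.and (hn_ev2.and (eventually_ge_atTop 2))).exists
  refine ⟨n, fun k ↦ -coeff ε n k, fun τ ↦ ?_, ?_⟩
  · push_cast
    rw [dirichletPoly_coeff, show (1 / 2 - ε + τ * I : ℂ) + 2 * ε = 1 / 2 + ε + τ * I by ring]
    refine (h21' n hn3 τ).trans ?_
    exact mul_le_mul_of_nonneg_right hn1.le (Real.rpow_nonneg (by positivity) _)
  · push_cast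
    rw [dirichletPoly_coeff, show (1 : ℂ) + 2 * ε = 1 + 2 * ε by rfl, one_div]
    exact hn2.le

open BaezDuarteOnlyIf in
/-- **The deep half of the Nyman–Beurling–Báez-Duarte criterion from the approximation property.**
If under RH, for all small `ε > 0`, `1/ζ` has the Dirichlet-polynomial approximation property
`InvZetaDirichletApprox ε`, and Lemma 2.2 (`baezDuarte_zetaRatio_bound`) and Littlewood's
`RH ⇒ ζ(σ+it) = O(t^δ)` for `σ > 1/2` (`zeta_isBigO_rpow_of_riemannHypothesis`, Titchmarsh
(14.2.5)) hold, then `baezDuarte_onlyIf`: under RH, `χ ∈ closure_{L²(0,∞)}(B_nat)`. Proof (§2.2,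
made quantitative so as to avoid the `L²`-Mellin transform of a limit function): for
`g_c = χ - ∑ c_k ρ_{k+1}` one has `‖g_c‖² ≤ (2π)⁻¹∫|M[g_c](1/2-ε+iτ)|²dτ + C²` (Mellin–Plancherel at
abscissa `1/2-ε`, `x^{-2ε} ≥ 1` on `(0,1]`, and `g_c = -C/x` on `(1,∞)` with `C = -D_c(1)`),
`M[g_c](w) = (1 - ζ(w)D_c(w))/w` (Titchmarsh (2.1.5)), and on the line
`|1 - ζ(w)D_c(w)|² ≤ 2|1 - ζ(w)/ζ(v)|² + 2|ζ(w)|²|D_c(w) - 1/ζ(v)|²` (`v = w + 2ε`) with the first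
term dominated (Lemma 2.2) and tending to `0` a.e. as `ε → 0`, the second
`≤ 64(C_R C₃ K)²(1+|τ|)^{-5/4}` (Lemma 2.2, (14.2.5)); choose `ε` small, then `K` small.
[cite: BaezDuarte2003, Thm. 1.1 and §2.2] -/
theorem baezDuarte_onlyIf_of_approx
    (hA : RiemannHypothesis → ∀ ε : ℝ, 0 < ε → ε ≤ 1 / 8 → InvZetaDirichletApprox ε)
    (h22 : baezDuarte_zetaRatio_bound) (h1425 : zeta_isBigO_rpow_of_riemannHypothesis) :
    baezDuarte_onlyIf := by
  intro hRH η hη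
  obtain ⟨C_R, hCR, hR⟩ := h22 (1 / 8) (by norm_num) (by norm_num)
  have hπ : 0 < π := Real.pi_pos
  ------------------------------------------------------------------
  -- Step 1: choose `ε = 1/(8(k+1))` with `∫ A(ε,·) < πη²/4` and `|1/ζ(1+2ε)| < η/4`.
  ------------------------------------------------------------------
  set e : ℕ → ℝ := fun k ↦ 1 / (8 * ((k : ℝ) + 1)) with he
  have he_pos : ∀ k, 0 < e k := fun k ↦ by positivity
  have he_le : ∀ k, e k ≤ 1 / 8 := by
    intro k
    simp only [he]
    rw [div_le_div_iff_of_pos_left (by norm_num) (by positivity) (by norm_num)]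
    nlinarith [(Nat.cast_nonneg k : (0 : ℝ) ≤ k)]
  have he_lim : Tendsto e atTop (𝓝 0) := by
    have h := (tendsto_one_div_add_atTop_nhds_zero_nat (𝕜 := ℝ)).const_mul (1 / 8)
    rw [mul_zero] at h
    refine h.congr fun k ↦ ?_
    simp only [he]
    field_simp
  have he_lim' : Tendsto e atTop (𝓝[>] 0) :=
    tendsto_nhdsWithin_of_tendsto_nhds_of_eventually_within _ he_lim
      (Eventually.of_forall he_pos)
  have hA_ev : ∀ᶠ k in atTop, ∫ τ : ℝ, Afun (e k) τ < π * η ^ 2 / 4 :=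
    (tendsto_integral_Afun hCR hR).eventually (gt_mem_nhds (by positivity))
  have hZ_ev : ∀ᶠ k in atTop, ‖(riemannZeta (1 + 2 * (e k : ℂ)))⁻¹‖ < η / 4 := by
    have h := (tendsto_inv_zeta_one.comp he_lim').norm
    rw [norm_zero] at h
    exact h.eventually (gt_mem_nhds (by positivity))
  obtain ⟨k, hkA, hkZ⟩ := (hA_ev.and hZ_ev).exists
  set ε : ℝ := e k with hε_def
  have hε0 : 0 < ε := he_pos k
  have hε1 : ε ≤ 1 / 8 := he_le k
  ------------------------------------------------------------------
  -- Step 2: the constants at this `ε` (RH enters here).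
  ------------------------------------------------------------------
  have hRH' := (forall_riemannZeta_ne_zero_iff_quasiRiemannHypothesis _).2
    (quasiRiemannHypothesis_one_half_iff_holds.2 hRH)
  have hv : ∀ τ : ℝ, riemannZeta (1 / 2 + ε + τ * I) ≠ 0 := fun τ ↦
    hRH' _ (by simp; linarith)
  obtain ⟨C₃, hC₃, h3⟩ : ∃ C₃ : ℝ, 0 < C₃ ∧
      ∀ τ : ℝ, ‖riemannZeta (1 / 2 + ε + τ * I)‖ ≤ C₃ * (1 + |τ|) ^ (1 / 8 : ℝ) := by
    obtain ⟨C, hC, hb⟩ := zeta_line_bound_of_isBigO (σ := 1 / 2 + ε) (δ := 1 / 8)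
      (by linarith) (by norm_num) (h1425 hRH (1 / 2 + ε) (1 / 8) (by linarith) (by norm_num))
    refine ⟨C, hC, fun τ ↦ ?_⟩
    have := hb τ
    push_cast at this
    exact this
  ------------------------------------------------------------------
  -- Step 3: choose the accuracy `K` of the Dirichlet polynomial, then the polynomial.
  ------------------------------------------------------------------
  set L : ℝ := ∫ τ : ℝ, (1 + |τ|) ^ (-(5 / 4) : ℝ) with hL
  have hKlim : Tendsto (fun K : ℝ ↦ 32 / π * (C_R * C₃ * K) ^ 2 * L) (𝓝[>] 0) (𝓝 0) := by
    have hc : Continuous fun K : ℝ ↦ 32 / π * (C_R * C₃ * K) ^ 2 * L := by fun_prop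
    have h := hc.tendsto 0
    simp only [mul_zero, ne_eq, OfNat.ofNat_ne_zero, not_false_eq_true, zero_pow, zero_mul] at h
    exact h.mono_left nhdsWithin_le_nhds
  have hK_ev1 : ∀ᶠ K : ℝ in 𝓝[>] 0, 32 / π * (C_R * C₃ * K) ^ 2 * L < η ^ 2 / 4 :=
    hKlim.eventually (gt_mem_nhds (by positivity))
  have hK_ev2 : ∀ᶠ K : ℝ in 𝓝[>] 0, K < η / 4 :=
    (tendsto_nhdsWithin_of_tendsto_nhds (f := fun K : ℝ ↦ K) tendsto_id).eventually
      (gt_mem_nhds (by positivity))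
  have hK_ev3 : ∀ᶠ K : ℝ in 𝓝[>] 0, 0 < K := self_mem_nhdsWithin
  obtain ⟨K, hK1, hK2, hK0⟩ := (hK_ev1.and (hK_ev2.and hK_ev3)).exists
  obtain ⟨N, d, hdD, hd1⟩ := hA hRH ε hε0 hε1 K hK0
  -- the coefficients of `Literature.NumberTheory.LFunctions.baezDuarte_iff` are `c = -d`
  set c : Fin N → ℝ := fun k ↦ -d k with hc_def
  have hcd : (fun k ↦ -(c k : ℂ)) = fun k ↦ (d k : ℂ) := by
    funext k; simp [hc_def]
  have hcD : ∀ τ : ℝ, ‖dirichletPoly (fun k ↦ -(c k : ℂ)) (1 / 2 - ε + τ * I) -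
      1 / riemannZeta (1 / 2 + ε + τ * I)‖ ≤ K * (1 + |τ|) ^ (1 / 8 : ℝ) := by
    rw [hcd]; exact hdD
  have hc1 : ‖dirichletPoly (fun k ↦ -(c k : ℂ)) 1 - 1 / riemannZeta (1 + 2 * ε)‖ ≤ K := by
    rw [hcd]; exact hd1
  have htail : |tailConst c| < η / 2 := by
    rw [abs_tailConst_eq]
    have h1 : ‖dirichletPoly (fun k ↦ -(c k : ℂ)) 1‖ ≤
        ‖dirichletPoly (fun k ↦ -(c k : ℂ)) 1 - 1 / riemannZeta (1 + 2 * ε)‖ +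
        ‖(riemannZeta (1 + 2 * ε))⁻¹‖ := by
      rw [← one_div]
      exact norm_le_norm_sub_add _ _
    have h2 : ‖(riemannZeta (1 + 2 * (ε : ℂ)))⁻¹‖ < η / 4 := hkZ
    linarith
  ------------------------------------------------------------------
  -- Step 4: the estimate.
  ------------------------------------------------------------------
  refine ⟨N, c, ?_⟩
  change eLpNorm (approx c) 2 (volume.restrict (Ioi 0)) < ENNReal.ofReal η
  have hmain : ∫ x in Ioi (0 : ℝ), approx c x ^ 2 < η ^ 2 := by
    have i1 := integral_sq_approx_le_mellin hε0.le (by linarith) c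
    have i2 := integral_norm_sq_mellin_le hε0 hε1 c hCR hC₃ hR hv hcD h3
    have i3 : tailConst c ^ 2 < η ^ 2 / 4 := by
      have := abs_nonneg (tailConst c)
      nlinarith [sq_abs (tailConst c)]
    have i4 : π⁻¹ * ∫ τ : ℝ, Afun ε τ < η ^ 2 / 4 := by
      rw [inv_mul_lt_iff₀ hπ]
      linarith
    calc ∫ x in Ioi (0 : ℝ), approx c x ^ 2
        ≤ (2 * π)⁻¹ * (∫ τ : ℝ, ‖mellin (approxC c) (((1 / 2 - ε : ℝ) : ℂ) + τ * I)‖ ^ 2) +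
            tailConst c ^ 2 := i1
      _ ≤ (2 * π)⁻¹ * (2 * (∫ τ : ℝ, Afun ε τ) + 64 * (C_R * C₃ * K) ^ 2 * L) +
            tailConst c ^ 2 := by gcongr
      _ = π⁻¹ * (∫ τ : ℝ, Afun ε τ) + 32 / π * (C_R * C₃ * K) ^ 2 * L + tailConst c ^ 2 := by
          field_simp
          ring
      _ < η ^ 2 / 4 + η ^ 2 / 4 + η ^ 2 / 4 := add_lt_add (add_lt_add i4 hK1) i3
      _ ≤ η ^ 2 := by nlinarith
  exact eLpNorm_lt_of_integral_sq_lt (measurable_approx c) (integrableOn_sq_approx c) hη hmain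

/-- **The deep half of the Nyman–Beurling–Báez-Duarte criterion from its printed inputs.**
Báez-Duarte's Lemma 2.1 (`baezDuarte_moebiusSum_approx`, Balazard–Saias), Lemma 2.2
(`baezDuarte_zetaRatio_bound`) and Littlewood's `RH ⇒ ζ(σ+it) = O(t^ε)` for `σ > 1/2`
(`zeta_isBigO_rpow_of_riemannHypothesis`, Titchmarsh (14.2.5) — the "Lindelöf hypothesis at the
abscissa `1/2 - ε`" of §2.2 once combined with Lemma 2.2) imply `baezDuarte_onlyIf`: under RH,
`χ ∈ closure_{L²(0,∞)}(B_nat)`, with Báez-Duarte's own approximants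
`-f_{2ε,n} = -∑_{a≤n} μ(a)a^{-2ε}ρ_a`. [cite: BaezDuarte2003, Thm. 1.1 and §2.2] -/
theorem baezDuarte_onlyIf_of_facts (h21 : baezDuarte_moebiusSum_approx)
    (h22 : baezDuarte_zetaRatio_bound) (h1425 : zeta_isBigO_rpow_of_riemannHypothesis) :
    baezDuarte_onlyIf :=
  baezDuarte_onlyIf_of_approx
    (fun hRH _ε hε0 hε1 ↦ invZetaDirichletApprox_of_moebiusSum_approx h21 hRH hε0 (by linarith))
    h22 h1425

/-- **Báez-Duarte's Theorem 1.1 from its printed inputs**: Lemma 2.1, Lemma 2.2 and (14.2.5) imply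
`Literature.NumberTheory.LFunctions.baezDuarte_iff` (the elementary half being `riemannHypothesis_of_beurling_closure`).
[cite: BaezDuarte2003, Thm. 1.1] -/
theorem baezDuarte_iff_of_facts (h21 : baezDuarte_moebiusSum_approx)
    (h22 : baezDuarte_zetaRatio_bound) (h1425 : zeta_isBigO_rpow_of_riemannHypothesis) :
    baezDuarte_iff :=
  baezDuarte_iff_of_onlyIf (baezDuarte_onlyIf_of_facts h21 h22 h1425)

end Literature.NumberTheory.LFunctions

end
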